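import Summits.NavierStokesRegularity.NavierStokesRegularity.Theorems.PoloidalWindowDoorPoloidalWindowRigidityZShockBreatherBound
import HarnessLib

/-!
# Crux K2 `PoloidalWindowRigidity` (stmt-NavierStokesRegularity-19708), line `z_shock` — tools for «no horizontally localised breathers»:
# the slope bound of the cutoff profile, shell domination, weighted horizontal integrals, and the thin-shell selection lemma

`--supports stmt-NavierStokesRegularity-19708 --as helper` (leafhand-ns-poloidalwindowdoor-3 g11, cell decomp-ns, 2026-08-31).  Def-free, class-free;
Mathlib + the cutoff tools of `…ZShockLocalEnergyCutoff`.  **No stub and no summit is closed by this file; Navier–Stokes regularity is NOT proved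
here (rung 0).**  Used by the sequel `…ZShockNoLocalizedBreather` (the theorem); contents:

* `deriv_profile_eq_zero_of_lt`, `exists_deriv_profile_bound` — the profile `u ↦ smoothTransition(b − u)` has slope `0` left of `b − 1` and a
  uniform slope bound `L` (continuity on `[0,1]`, constancy outside);
* `abs_deriv_profile_mul_le` — SHELL DOMINATION `|χ_a'(v)|·v ≤ L(a+1)(χ_{a+1}(v) − χ_{a−1}(v))` (`a, v ≥ 0`);
* `continuous_weighted`, `integrable_weighted`, `hasCompactSupport_of_eq_zero`, `cutoff_zero_of_lt`, `continuous_cutoff` — height-continuity and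
  slice-integrability of `s ↦ ∫ ρ(y) K(s,y) dy` for a continuous weight vanishing outside a ball (`Literature…continuousOn_integral_of_support_subset`);
* `exists_small_weighted_term` — SELECTION: non-negative `h k` with bounded partial sums admit `k` with `(a + 2k + 2)·h k < ε` (harmonic series).
[folklore]
-/

noncomputable section

namespace Summit.NavierStokesRegularity.NavierStokesRegularity.Theorems.PoloidalWindowDoorPoloidalWindowRigidityZShockNoLocalizedBreatherTools

-- the summit and its single sub-problem share the name (CONVENTIONS §1)
set_option linter.dupNamespace false

open Set Filter Topology Function MeasureTheory Metric
open scoped ContDiff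
open Literature.Analysis.FluidPDE (continuousOn_integral_of_support_subset)
open Summit.NavierStokesRegularity.NavierStokesRegularity.Theorems.PoloidalWindowDoorPoloidalWindowRigidityZShockLocalEnergyCutoff

/-! ### The cutoff profile: a uniform bound on its slope and the shell domination -/

/-- The derivative of the profile vanishes on `(−∞, b − 1)` (where the profile is `≡ 1`). [folklore] -/
theorem deriv_profile_eq_zero_of_lt {b u : ℝ} (h : u + 1 < b) :
    deriv (fun v : ℝ => Real.smoothTransition (b - v)) u = 0 := by
  have he : (fun v : ℝ => Real.smoothTransition (b - v)) =ᶠ[𝓝 u] fun _ => 1 := by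
    filter_upwards [gt_mem_nhds (show u < b - 1 by linarith)] with v hv
    exact profile_eq_one (by linarith [hv])
  rw [he.deriv_eq, deriv_const]

/-- **A uniform bound on the slope of the profile**: `|(d/du) smoothTransition(b − u)| ≤ L` for all `b, u`, some `L ≥ 0`. [folklore] -/
theorem exists_deriv_profile_bound :
    ∃ L : ℝ, 0 ≤ L ∧ ∀ b u : ℝ, |deriv (fun v : ℝ => Real.smoothTransition (b - v)) u| ≤ L := by
  have hc : Continuous (deriv Real.smoothTransition) :=
    (Real.smoothTransition.contDiff (n := ⊤)).continuous_deriv (by simp)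
  obtain ⟨L₀, hL₀⟩ := isCompact_Icc.exists_bound_of_continuousOn (s := Icc (0 : ℝ) 1) hc.continuousOn
  refine ⟨max L₀ 0, le_max_right _ _, fun b u => ?_⟩
  rw [(hasDerivAt_profile b u).deriv, abs_neg]
  set x := b - u with hx
  by_cases h0 : x < 0
  · have he : Real.smoothTransition =ᶠ[𝓝 x] fun _ => 0 := by
      filter_upwards [gt_mem_nhds h0] with v hv using Real.smoothTransition.zero_of_nonpos hv.le
    rw [he.deriv_eq, deriv_const, abs_zero]; exact le_max_right _ _
  by_cases h1 : 1 < x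
  · have he : Real.smoothTransition =ᶠ[𝓝 x] fun _ => 1 := by
      filter_upwards [lt_mem_nhds h1] with v hv using Real.smoothTransition.one_of_one_le hv.le
    rw [he.deriv_eq, deriv_const, abs_zero]; exact le_max_right _ _
  · have hxI : x ∈ Icc (0 : ℝ) 1 := ⟨not_lt.1 h0, not_lt.1 h1⟩
    exact ((Real.norm_eq_abs _).symm.le.trans (hL₀ x hxI)).trans (le_max_left _ _)

/-- **Shell domination.**  With `L` as above and `a ≥ 0`: `|χ_a'(v)|·v ≤ L(a+1)(χ_{a+1}(v) − χ_{a−1}(v))` for `v ≥ 0`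
(`χ_a(v) = smoothTransition(a + 1 − v)`; the slope lives in `a ≤ v ≤ a+1`, where `χ_{a+1} = 1` and `χ_{a−1} = 0`). [folklore] -/
theorem abs_deriv_profile_mul_le {L : ℝ} (hL0 : 0 ≤ L) (hL : ∀ b u : ℝ, |deriv (fun v : ℝ => Real.smoothTransition (b - v)) u| ≤ L)
    {a v : ℝ} (ha : 0 ≤ a) (hv : 0 ≤ v) :
    |deriv (fun t : ℝ => Real.smoothTransition (a + 1 - t)) v| * v ≤
      L * (a + 1) * (Real.smoothTransition (a + 2 - v) - Real.smoothTransition (a - v)) := by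
  have hmono : Real.smoothTransition (a - v) ≤ Real.smoothTransition (a + 2 - v) :=
    Real.smoothTransition.monotone (by linarith)
  have hR0 : 0 ≤ L * (a + 1) * (Real.smoothTransition (a + 2 - v) - Real.smoothTransition (a - v)) := by
    have : 0 ≤ a + 1 := by linarith
    have : 0 ≤ Real.smoothTransition (a + 2 - v) - Real.smoothTransition (a - v) := by linarith
    positivity
  by_cases h1 : a + 1 < v
  · rw [deriv_profile_eq_zero h1, abs_zero, zero_mul]; exact hR0
  by_cases h2 : v < a
  · rw [deriv_profile_eq_zero_of_lt (by linarith), abs_zero, zero_mul]; exact hR0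
  · have hv1 : v ≤ a + 1 := not_lt.1 h1
    have hv2 : a ≤ v := not_lt.1 h2
    rw [Real.smoothTransition.one_of_one_le (by linarith), Real.smoothTransition.zero_of_nonpos (by linarith), sub_zero, mul_one]
    exact mul_le_mul (hL _ _) hv1 hv (hL0)

/-! ### Weighted horizontal integrals: continuity in the height, integrability -/

/-- A continuous weight vanishing outside a ball has compact support. [folklore] -/
theorem hasCompactSupport_of_eq_zero {ρ : EuclideanSpace ℝ (Fin 2) → ℝ} {R : ℝ} (hρ0 : ∀ y, R < ‖y‖ → ρ y = 0) :
    HasCompactSupport ρ := by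
  refine HasCompactSupport.intro (isCompact_closedBall (0 : EuclideanSpace ℝ (Fin 2)) R) fun y hy => ?_
  rw [mem_closedBall, dist_zero_right, not_le] at hy
  exact hρ0 y hy

/-- **Continuity in the height of a weighted horizontal integral** `s ↦ ∫ ρ(y) K(s,y) dy` (jointly continuous `K`, continuous weight
vanishing outside a ball). [folklore] -/
theorem continuous_weighted {K : ℝ → EuclideanSpace ℝ (Fin 2) → ℝ} (hK : Continuous (uncurry K))
    {ρ : EuclideanSpace ℝ (Fin 2) → ℝ} (hρ : Continuous ρ) {R : ℝ} (hρ0 : ∀ y, R < ‖y‖ → ρ y = 0) :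
    Continuous fun s => ∫ y, ρ y * K s y := by
  have h := continuousOn_integral_of_support_subset (μ := (volume : Measure (EuclideanSpace ℝ (Fin 2))))
    (S := univ) (Φ := fun s y => ρ y * K s y) (isCompact_closedBall (0 : EuclideanSpace ℝ (Fin 2)) R)
    ((hρ.comp continuous_snd).mul hK).continuousOn (fun s _ y hy => by
      rw [mem_closedBall, dist_zero_right, not_le] at hy
      show ρ y * K s y = 0
      rw [hρ0 y hy, zero_mul])
  exact continuousOn_univ.1 h

/-- Integrability of a slice of a weighted integrand. [folklore] -/
theorem integrable_weighted {K : ℝ → EuclideanSpace ℝ (Fin 2) → ℝ} (hK : Continuous (uncurry K))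
    {ρ : EuclideanSpace ℝ (Fin 2) → ℝ} (hρ : Continuous ρ) {R : ℝ} (hρ0 : ∀ y, R < ‖y‖ → ρ y = 0) (s : ℝ) :
    Integrable fun y => ρ y * K s y :=
  (hρ.mul (hK.comp (Continuous.prodMk_right s))).integrable_of_hasCompactSupport (hasCompactSupport_of_eq_zero hρ0).mul_right

/-- The cutoff `χ_a(y) = smoothTransition(a + 1 − ⟨y⟩)` vanishes outside the ball of radius `a + 1`. [folklore] -/
theorem cutoff_zero_of_lt (a : ℝ) (y : EuclideanSpace ℝ (Fin 2)) (hy : a + 1 < ‖y‖) :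
    Real.smoothTransition (a + 1 - √(1 + ‖y‖ ^ 2)) = 0 :=
  profile_eq_zero (by linarith [norm_le_bracket y])

/-- The cutoff is continuous in `y`. [folklore] -/
theorem continuous_cutoff (a : ℝ) : Continuous fun y : EuclideanSpace ℝ (Fin 2) => Real.smoothTransition (a + 1 - √(1 + ‖y‖ ^ 2)) :=
  (contDiff_profile (a + 1) (k := 0)).continuous.comp (contDiff_bracket (k := 0)).continuous

/-! ### Selection of a thin shell -/

/-- **Selection lemma.**  Non-negative numbers `h k` with bounded partial sums have, for every `ε > 0` and `a ≥ 0`, an index `k` with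
`(a + 2k + 2)·h k < ε` (otherwise `h k ≥ ε/((a+2)(k+1))` and the harmonic series would be bounded). [folklore] -/
theorem exists_small_weighted_term {h : ℕ → ℝ} {D a : ℝ} (h0 : ∀ k, 0 ≤ h k) (hD : ∀ N, ∑ k ∈ Finset.range N, h k ≤ D)
    (ha : 0 ≤ a) {ε : ℝ} (hε : 0 < ε) : ∃ k : ℕ, (a + 2 * k + 2) * h k < ε := by
  by_contra hcon
  push Not at hcon
  -- `h k ≥ ε / ((a + 2) (k + 1))`
  have hk : ∀ k : ℕ, ε / (a + 2) * (1 / ((k : ℝ) + 1)) ≤ h k := by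
    intro k
    have h1 : (a + 2 * k + 2) ≤ (a + 2) * ((k : ℝ) + 1) := by nlinarith [(k : ℕ).cast_nonneg (α := ℝ)]
    have h2 : 0 < a + 2 * (k : ℝ) + 2 := by positivity
    have h3 := hcon k
    rw [div_mul_div_comm, mul_one, div_le_iff₀ (by positivity)]
    calc ε ≤ (a + 2 * k + 2) * h k := h3
      _ ≤ (a + 2) * ((k : ℝ) + 1) * h k := mul_le_mul_of_nonneg_right h1 (h0 k)
      _ = h k * ((a + 2) * ((k : ℝ) + 1)) := by ring
  have hsum : ∀ N, ε / (a + 2) * ∑ k ∈ Finset.range N, (1 / ((k : ℝ) + 1)) ≤ D := fun N => by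
    rw [Finset.mul_sum]
    exact (Finset.sum_le_sum fun k _ => hk k).trans (hD N)
  have hc : 0 < ε / (a + 2) := by positivity
  obtain ⟨N, hN⟩ := (tendsto_atTop_atTop.1 Real.tendsto_sum_range_one_div_nat_succ_atTop) (D / (ε / (a + 2)) + 1)
  have h := hN N le_rfl
  have h' := hsum N
  rw [← le_div_iff₀' hc] at h'
  linarith


end Summit.NavierStokesRegularity.NavierStokesRegularity.Theorems.PoloidalWindowDoorPoloidalWindowRigidityZShockNoLocalizedBreatherTools

end
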